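import Mathlib
import Summits.NavierStokesRegularity.NavierStokesRegularity.Theorems.EulerZoomLiouvillePowerGaugeEulerLiouvilleSelfSimilarEndpointPressureMid
import HarnessLib

/-!
# Rung C1 of the crux `EulerZoomLiouville.PowerGaugeEulerLiouville` at the endpoint `ρ = 1/2`:
# the pressure and cubic terms on a dyadic shell (Chae–Shvydkoy 2013, proof of Thm 3.1)

Route №10 `EulerZoomLiouville` (NavierStokesRegularity), crux E = stmt-NavierStokesRegularity-19832,
tenure rung C1 at the endpoint.  For a profile `V ∈ L² ∩ L³_loc` with the sublinear growth
`‖V(y)‖ ≤ C_up |y|^{1−δ}` (`|y| ≥ R₀`) and a pressure `P` which, below `|y| < 16L`, is the Riesz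
pressure of `V·1_{B_{32L}}` plus the honest kernel integral of the sources `|z| ≥ 32L`, we bound
the flux integrand of the shell `S_L = {L/4 ≤ |y| ≤ 8L}` as in Chae–Shvydkoy's proof of Thm 3.1
(arXiv:1201.6009, §3.1), but keeping the far-field terms SUBLINEAR (no lower bound on `V` used):

* (prequel `…EndpointPressureMid`: the mid sources by Calderón–Zygmund in `L²`);
* `ae_abs_near_add_far_le` — near and far sources are `≤ 2‖V‖₂²/(2π (L/8)³)` a.e. on `S_L`;
* `shell_pressure_le` — `∫_{S_L} |P| ‖V‖ ≤ C_S C_up (32L)^{1−δ} e_T(L) + 2N_L √(vol B_{8L}) √(e_S(L))`,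
  `T_L = {L/8 ≤ |y| < 32L}`, `N_L = ‖V‖₂²/(2π (L/8)³)`;
* `shell_cubic_le` — `∫_{S_L} ‖V‖³ ≤ C_up (8L)^{1−δ} e_S(L)`.

WHAT THIS IS NOT: not NS, not E, not rung C1 — the analytic input of one endpoint stratum.
-/

noncomputable section

-- flat `Theorems/<Route><Decl>…` files of one crux share the namespace of the crux (tree convention)
set_option linter.dupNamespace false

open MeasureTheory Set Filter Topology Metric Function
open scoped ENNReal NNReal InnerProductSpace RealInnerProductSpace

namespace Summit.NavierStokesRegularity.NavierStokesRegularity.Theorems.PowerGaugeEulerLiouville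

open Literature.Analysis Literature.Analysis.FluidPDE

section NearFar

variable {V : EuclideanSpace ℝ (Fin 3) → EuclideanSpace ℝ (Fin 3)}

/-- **Near and far sources on the shell `S_L = {L/4 ≤ |y| ≤ 8L}`:** for a.e. `y ∈ S_L`,
`|Π[V·1_{B_{L/8}}](y)| + |∫_{|z| ≥ 32L} K(y−z)(V z) dz| ≤ 2 ‖V‖₂² / (2π (L/8)³)`.
[cite: ChaeShvydkoy2013, §3.1 proof of Thm. 3.1 (the terms q₁, q₃)] -/
theorem ae_abs_near_add_far_le (hV2 : Integrable (fun z => ‖V z‖ ^ 2) volume) {L : ℝ}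
    (hL : 0 < L)
    (hV3 : MemLp ((ball (0 : EuclideanSpace ℝ (Fin 3)) (L / 8)).indicator V) 3 volume) :
    ∀ᵐ y : EuclideanSpace ℝ (Fin 3), L / 4 ≤ ‖y‖ → ‖y‖ ≤ 8 * L →
      |rieszPressure ((ball (0 : EuclideanSpace ℝ (Fin 3)) (L / 8)).indicator V) y| +
          |∫ z in {z | 32 * L ≤ ‖z‖}, pressureKernel (y - z) (V z)| ≤
        2 * ((∫ z, ‖V z‖ ^ 2) / (2 * Real.pi * (L / 8) ^ 3)) := by
  have hr : 0 < L / 8 := by positivity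
  filter_upwards [rieszPressure_indicator_ball_ae_eq_integral hr hV3] with y hy h1 h2
  have hy' : 2 * (L / 8) ≤ ‖y‖ := by linarith
  rw [hy hy']
  have hnear := abs_integral_pressureKernel_near_le hV2 hr hy'
  have hfar := abs_setIntegral_pressureKernel_far_le hV2 (by positivity : 0 < 32 * L)
    (by linarith : ‖y‖ ≤ 32 * L / 2)
  have hE0 : 0 ≤ ∫ z, ‖V z‖ ^ 2 := integral_nonneg fun z => by positivity
  have hcmp : 8 * (∫ z, ‖V z‖ ^ 2) / (2 * Real.pi * (32 * L) ^ 3) ≤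
      (∫ z, ‖V z‖ ^ 2) / (2 * Real.pi * (L / 8) ^ 3) := by
    rw [div_le_div_iff₀ (by positivity) (by positivity)]
    have : 8 * (2 * Real.pi * (L / 8) ^ 3) ≤ 2 * Real.pi * (32 * L) ^ 3 := by
      nlinarith [Real.pi_pos, pow_pos hL 3]
    calc 8 * (∫ z, ‖V z‖ ^ 2) * (2 * Real.pi * (L / 8) ^ 3)
        = (∫ z, ‖V z‖ ^ 2) * (8 * (2 * Real.pi * (L / 8) ^ 3)) := by ring
      _ ≤ (∫ z, ‖V z‖ ^ 2) * (2 * Real.pi * (32 * L) ^ 3) :=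
          mul_le_mul_of_nonneg_left this hE0
  linarith

end NearFar

section Shell

variable {V : EuclideanSpace ℝ (Fin 3) → EuclideanSpace ℝ (Fin 3)} {P : EuclideanSpace ℝ (Fin 3) → ℝ}

/-- **The pressure term on the shell** (Chae–Shvydkoy's `(1/L)∫|v||q|`, with sublinear far
field).  Hypotheses: `V ∈ L²`, `‖V‖³ ∈ L¹_loc`, `|P|‖V‖ ∈ L¹_loc`, sublinear growth
`‖V(y)‖ ≤ C_up |y|^{1−δ}` for `|y| ≥ R₀` (`0 < δ ≤ 1`), a Stein constant `C_S`, a scale `L` with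
`R₀ ≤ L/8`, and the Riesz representation of `P` below `|y| < 16L` at source scale `32L`.  Then
`∫_{S_L} |P| ‖V‖ ≤ C_S C_up (32L)^{1−δ} ∫_{T_L} ‖V‖² + 2 N_L √(vol B̄_{8L}) √(∫_{S_L} ‖V‖²)`,
`S_L = {L/4 ≤ |y| ≤ 8L}`, `T_L = {L/8 ≤ |y| < 32L}`, `N_L = ‖V‖₂²/(2π (L/8)³)`.
[cite: ChaeShvydkoy2013, §3.1 proof of Thm. 3.1 (pressure terms of (3.3))] -/
theorem shell_pressure_le {C_S : ℝ≥0}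
    (hCS : ∀ w : EuclideanSpace ℝ (Fin 3) → EuclideanSpace ℝ (Fin 3), MemLp w 3 volume →
      MemLp w 4 volume → eLpNorm (rieszPressure w) 2 volume ≤ C_S * eLpNorm w 4 volume ^ 2)
    (hVm : AEStronglyMeasurable V volume) (hV2 : Integrable (fun z => ‖V z‖ ^ 2) volume)
    (hV3 : LocallyIntegrable (fun y => ‖V y‖ ^ 3) volume)
    (hPV : LocallyIntegrable (fun y => |P y| * ‖V y‖) volume)
    {δ Cup R₀ : ℝ} (hδ1 : δ ≤ 1) (hCup : 0 ≤ Cup)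
    (hup : ∀ᵐ y ∂volume, R₀ ≤ ‖y‖ → ‖V y‖ ≤ Cup * ‖y‖ ^ (1 - δ))
    {L : ℝ} (hL : 0 < L) (hLR : R₀ ≤ L / 8)
    (hP : ∀ᵐ y ∂volume, ‖y‖ < 16 * L →
      P y = rieszPressure ((ball (0 : EuclideanSpace ℝ (Fin 3)) (32 * L)).indicator V) y +
        ∫ z in {z | 32 * L ≤ ‖z‖}, pressureKernel (y - z) (V z)) :
    ∫ y in {y | L / 4 ≤ ‖y‖ ∧ ‖y‖ ≤ 8 * L}, |P y| * ‖V y‖ ≤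
      C_S * (Cup * (32 * L) ^ (1 - δ)) * (∫ y in {y | L / 8 ≤ ‖y‖ ∧ ‖y‖ < 32 * L}, ‖V y‖ ^ 2) +
        2 * ((∫ z, ‖V z‖ ^ 2) / (2 * Real.pi * (L / 8) ^ 3)) *
          Real.sqrt (volume.real (closedBall (0 : EuclideanSpace ℝ (Fin 3)) (8 * L))) *
          Real.sqrt (∫ y in {y | L / 4 ≤ ‖y‖ ∧ ‖y‖ ≤ 8 * L}, ‖V y‖ ^ 2) := by
  -- the sets
  set S : Set (EuclideanSpace ℝ (Fin 3)) := {y | L / 4 ≤ ‖y‖ ∧ ‖y‖ ≤ 8 * L} with hSdef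
  set T : Set (EuclideanSpace ℝ (Fin 3)) := {y | L / 8 ≤ ‖y‖ ∧ ‖y‖ < 32 * L} with hTdef
  have hS : MeasurableSet S := (measurableSet_le measurable_const measurable_norm).inter
    (measurableSet_le measurable_norm measurable_const)
  have hT : MeasurableSet T := (measurableSet_le measurable_const measurable_norm).inter
    (measurableSet_lt measurable_norm measurable_const)
  have hST : S ⊆ T := fun y hy => ⟨by linarith [hy.1], by linarith [hy.2]⟩
  have hTR : T ⊆ closedBall (0 : EuclideanSpace ℝ (Fin 3)) (32 * L) := fun y hy => by
    rw [mem_closedBall, dist_zero_right]; exact hy.2.le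
  have hS8 : S ⊆ closedBall (0 : EuclideanSpace ℝ (Fin 3)) (8 * L) := fun y hy => by
    rw [mem_closedBall, dist_zero_right]; exact hy.2
  have hμS : volume S ≠ ⊤ := (lt_of_le_of_lt (measure_mono hS8) measure_closedBall_lt_top).ne
  -- the three source fields
  set Unear := (ball (0 : EuclideanSpace ℝ (Fin 3)) (L / 8)).indicator V with hUnear
  set Umid := T.indicator V with hUmid
  set U32 := (ball (0 : EuclideanSpace ℝ (Fin 3)) (32 * L)).indicator V with hU32
  have hnear3 : MemLp Unear 3 volume :=
    memLp_indicator_three_of_subset hVm hV3 measurableSet_ball ball_subset_closedBall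
  have h32_3 : MemLp U32 3 volume :=
    memLp_indicator_three_of_subset hVm hV3 measurableSet_ball ball_subset_closedBall
  -- the sup bound on `T` (hence on `S`)
  set M : ℝ := Cup * (32 * L) ^ (1 - δ) with hMdef
  have hM0 : 0 ≤ M := by positivity
  have hMT : ∀ᵐ y ∂volume, y ∈ T → ‖V y‖ ≤ M := by
    filter_upwards [hup] with y hy hyT
    have hR : R₀ ≤ ‖y‖ := hLR.trans hyT.1
    refine (hy hR).trans (mul_le_mul_of_nonneg_left ?_ hCup)
    exact Real.rpow_le_rpow (norm_nonneg _) hyT.2.le (by linarith)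
  have hμT : volume T ≠ ⊤ := (lt_of_le_of_lt (measure_mono hTR) measure_closedBall_lt_top).ne
  have hmid3 : MemLp Umid 3 volume := memLp_indicator_of_bound hVm hT hμT hMT 3
  -- additivity `Π[U32] = Π[Unear] + Π[Umid]` a.e.
  have hsplit : rieszPressure U32 =ᵐ[volume] fun y => rieszPressure Unear y + rieszPressure Umid y := by
    refine rieszPressure_add_ae_eq_of_disjoint h32_3 hnear3 hmid3 (fun y => ?_)
      (Eventually.of_forall fun y => ?_)
    · by_cases hy : y ∈ ball (0 : EuclideanSpace ℝ (Fin 3)) (L / 8)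
      · right
        rw [hUmid, indicator_of_notMem]
        intro hyT
        rw [mem_ball, dist_zero_right] at hy
        linarith [hyT.1]
      · left; rw [hUnear, indicator_of_notMem hy]
    · show U32 y = Unear y + Umid y
      by_cases h1 : y ∈ ball (0 : EuclideanSpace ℝ (Fin 3)) (L / 8)
      · have h1' : ‖y‖ < L / 8 := by rwa [mem_ball, dist_zero_right] at h1
        have h32 : y ∈ ball (0 : EuclideanSpace ℝ (Fin 3)) (32 * L) := by
          rw [mem_ball, dist_zero_right]; linarith
        have hT' : y ∉ T := fun h => by linarith [h.1]
        rw [hU32, hUnear, hUmid, indicator_of_mem h32, indicator_of_mem h1,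
          indicator_of_notMem hT', add_zero]
      · have h1' : L / 8 ≤ ‖y‖ := by rwa [mem_ball, dist_zero_right, not_lt] at h1
        by_cases h2 : ‖y‖ < 32 * L
        · have h32 : y ∈ ball (0 : EuclideanSpace ℝ (Fin 3)) (32 * L) := by
            rwa [mem_ball, dist_zero_right]
          rw [hU32, hUnear, hUmid, indicator_of_mem h32, indicator_of_notMem h1,
            indicator_of_mem (show y ∈ T from ⟨h1', h2⟩), zero_add]
        · have h32 : y ∉ ball (0 : EuclideanSpace ℝ (Fin 3)) (32 * L) := by
            rwa [mem_ball, dist_zero_right]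
          have hT' : y ∉ T := fun h => h2 h.2
          rw [hU32, hUnear, hUmid, indicator_of_notMem h32, indicator_of_notMem h1,
            indicator_of_notMem hT', add_zero]
  -- the pointwise bound `|P| ≤ |Π[Umid]| + 2N` a.e. on `S`
  set N : ℝ := (∫ z, ‖V z‖ ^ 2) / (2 * Real.pi * (L / 8) ^ 3) with hNdef
  have hN0 : 0 ≤ N := by
    rw [hNdef]; exact div_nonneg (integral_nonneg fun z => by positivity) (by positivity)
  have hptS : ∀ᵐ y ∂volume, y ∈ S →
      |P y| * ‖V y‖ ≤ |rieszPressure Umid y| * ‖V y‖ + 2 * N * ‖V y‖ := by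
    filter_upwards [hP, hsplit, ae_abs_near_add_far_le hV2 hL hnear3] with y hPy hsy hnf hyS
    have hy16 : ‖y‖ < 16 * L := by linarith [hyS.2]
    have hnf' := hnf hyS.1 hyS.2
    rw [hPy hy16, hsy]
    have htri : |rieszPressure Unear y + rieszPressure Umid y +
        ∫ z in {z | 32 * L ≤ ‖z‖}, pressureKernel (y - z) (V z)| ≤
        |rieszPressure Umid y| + (|rieszPressure Unear y| +
          |∫ z in {z | 32 * L ≤ ‖z‖}, pressureKernel (y - z) (V z)|) := by
      have := abs_add_le (rieszPressure Unear y + rieszPressure Umid y)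
        (∫ z in {z | 32 * L ≤ ‖z‖}, pressureKernel (y - z) (V z))
      have := abs_add_le (rieszPressure Unear y) (rieszPressure Umid y)
      linarith
    calc |rieszPressure Unear y + rieszPressure Umid y +
          ∫ z in {z | 32 * L ≤ ‖z‖}, pressureKernel (y - z) (V z)| * ‖V y‖
        ≤ (|rieszPressure Umid y| + 2 * N) * ‖V y‖ := by
          refine mul_le_mul_of_nonneg_right (htri.trans ?_) (norm_nonneg _)
          linarith
      _ = |rieszPressure Umid y| * ‖V y‖ + 2 * N * ‖V y‖ := by ring
  -- integrability on `S`
  have hV2T : IntegrableOn (fun y => ‖V y‖ ^ 2) T volume := hV2.integrableOn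
  have hV2S : MemLp V 2 (volume.restrict S) :=
    (memLp_two_iff_integrable_sq_norm hVm.restrict).2 (hV2.integrableOn)
  have hmid4 : MemLp Umid 4 volume := memLp_indicator_of_bound hVm hT hμT hMT 4
  have hQm : AEStronglyMeasurable (rieszPressure Umid) volume := aestronglyMeasurable_rieszPressure hmid3
  have hQ2 : MemLp (rieszPressure Umid) 2 volume := by
    refine ⟨hQm, lt_of_le_of_lt (hCS Umid hmid3 hmid4) ?_⟩
    exact ENNReal.mul_lt_top ENNReal.coe_lt_top (ENNReal.pow_lt_top hmid4.eLpNorm_lt_top)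
  haveI : IsFiniteMeasure (volume.restrict S) := isFiniteMeasure_restrict.2 hμS
  have hV1S : Integrable (fun y => ‖V y‖) (volume.restrict S) := hV2S.norm.integrable one_le_two
  have hint1 : IntegrableOn (fun y => |rieszPressure Umid y| * ‖V y‖) S volume := by
    have h := (hQ2.restrict S).norm.integrable_mul hV2S.norm
    rw [IntegrableOn]
    convert h using 1
    funext y
    simp only [Pi.mul_apply, Real.norm_eq_abs]
  have hintLHS : IntegrableOn (fun y => |P y| * ‖V y‖) S volume :=
    (hPV.integrableOn_isCompact (isCompact_closedBall 0 (8 * L))).mono_set hS8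
  -- integrate the pointwise bound
  have hI : ∫ y in S, |P y| * ‖V y‖ ≤
      (∫ y in S, |rieszPressure Umid y| * ‖V y‖) + 2 * N * ∫ y in S, ‖V y‖ := by
    rw [← integral_const_mul, ← integral_add hint1 (hV1S.const_mul _)]
    exact setIntegral_mono_on_ae hintLHS (hint1.add (hV1S.const_mul _)) hS hptS
  -- the two pieces
  have hmid := setIntegral_abs_rieszPressure_mul_norm_le hCS hVm hS hT hST hTR hM0 hMT hV2T
  have hone : ∫ y in S, ‖V y‖ ≤ Real.sqrt (volume.real S) *
      Real.sqrt (∫ y in S, ‖V y‖ ^ 2) := by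
    have h := setIntegral_abs_mul_norm_le_sqrt (S := S) (f := fun _ => (1 : ℝ))
      (memLp_const 1) hV2S
    simp only [abs_one, one_mul, one_pow, setIntegral_const, smul_eq_mul, mul_one] at h
    exact h
  have hvol : Real.sqrt (volume.real S) ≤
      Real.sqrt (volume.real (closedBall (0 : EuclideanSpace ℝ (Fin 3)) (8 * L))) :=
    Real.sqrt_le_sqrt (measureReal_mono hS8 measure_closedBall_lt_top.ne)
  calc ∫ y in S, |P y| * ‖V y‖
      ≤ (∫ y in S, |rieszPressure Umid y| * ‖V y‖) + 2 * N * ∫ y in S, ‖V y‖ := hI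
    _ ≤ C_S * M * (∫ y in T, ‖V y‖ ^ 2) +
          2 * N * (Real.sqrt (volume.real (closedBall (0 : EuclideanSpace ℝ (Fin 3)) (8 * L))) *
            Real.sqrt (∫ y in S, ‖V y‖ ^ 2)) := by
        gcongr
        exact hone.trans (mul_le_mul_of_nonneg_right hvol (Real.sqrt_nonneg _))
    _ = C_S * (Cup * (32 * L) ^ (1 - δ)) * (∫ y in T, ‖V y‖ ^ 2) +
          2 * ((∫ z, ‖V z‖ ^ 2) / (2 * Real.pi * (L / 8) ^ 3)) *
            Real.sqrt (volume.real (closedBall (0 : EuclideanSpace ℝ (Fin 3)) (8 * L))) *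
            Real.sqrt (∫ y in S, ‖V y‖ ^ 2) := by
        rw [hMdef, hNdef]; ring

/-- **The cubic term on the shell:** `∫_{S_L} ‖V‖³ ≤ C_up (8L)^{1−δ} ∫_{S_L} ‖V‖²` under the
sublinear growth bound (`R₀ ≤ L/4`). [cite: ChaeShvydkoy2013, §3.1 proof of Thm. 3.1 (first term of (3.3))] -/
theorem shell_cubic_le (hV2 : Integrable (fun z => ‖V z‖ ^ 2) volume)
    (hV3 : LocallyIntegrable (fun y => ‖V y‖ ^ 3) volume)
    {δ Cup R₀ : ℝ} (hδ1 : δ ≤ 1) (hCup : 0 ≤ Cup)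
    (hup : ∀ᵐ y ∂volume, R₀ ≤ ‖y‖ → ‖V y‖ ≤ Cup * ‖y‖ ^ (1 - δ))
    {L : ℝ} (hLR : R₀ ≤ L / 4) :
    ∫ y in {y | L / 4 ≤ ‖y‖ ∧ ‖y‖ ≤ 8 * L}, ‖V y‖ ^ 3 ≤
      Cup * (8 * L) ^ (1 - δ) * ∫ y in {y | L / 4 ≤ ‖y‖ ∧ ‖y‖ ≤ 8 * L}, ‖V y‖ ^ 2 := by
  set S : Set (EuclideanSpace ℝ (Fin 3)) := {y | L / 4 ≤ ‖y‖ ∧ ‖y‖ ≤ 8 * L} with hSdef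
  have hS : MeasurableSet S := (measurableSet_le measurable_const measurable_norm).inter
    (measurableSet_le measurable_norm measurable_const)
  have hS8 : S ⊆ closedBall (0 : EuclideanSpace ℝ (Fin 3)) (8 * L) := fun y hy => by
    rw [mem_closedBall, dist_zero_right]; exact hy.2
  have hint3 : IntegrableOn (fun y => ‖V y‖ ^ 3) S volume :=
    (hV3.integrableOn_isCompact (isCompact_closedBall 0 (8 * L))).mono_set hS8
  rw [← integral_const_mul]
  refine setIntegral_mono_on_ae hint3 (hV2.integrableOn.const_mul _) hS ?_
  filter_upwards [hup] with y hy hyS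
  have hR : R₀ ≤ ‖y‖ := hLR.trans hyS.1
  have hVy : ‖V y‖ ≤ Cup * (8 * L) ^ (1 - δ) :=
    (hy hR).trans (mul_le_mul_of_nonneg_left
      (Real.rpow_le_rpow (norm_nonneg _) hyS.2 (by linarith)) hCup)
  calc ‖V y‖ ^ 3 = ‖V y‖ * ‖V y‖ ^ 2 := by ring
    _ ≤ Cup * (8 * L) ^ (1 - δ) * ‖V y‖ ^ 2 := mul_le_mul_of_nonneg_right hVy (by positivity)

end Shell

end Summit.NavierStokesRegularity.NavierStokesRegularity.Theorems.PowerGaugeEulerLiouville
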